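import Summits.Ventures.PercRepro2.CaseOneStarCertT1
import Summits.Ventures.PercRepro2.CaseOneGadgetUWA1BBlockIT0
import Summits.Ventures.PercRepro2.CaseOneGadgetUWA1BBlockIT1
import Summits.Ventures.PercRepro2.CaseOneGadgetUWA1BBlockIT2
import Summits.Ventures.PercRepro2.CaseOneGadgetUWA1BBlockIT3
import Summits.Ventures.PercRepro2.CaseOneGadgetUWA1BBlockIT4
import Summits.Ventures.PercRepro2.CaseOneGadgetUWA1BBlockIT5
import Summits.Ventures.PercRepro2.CaseOneGadgetUWA1BBlockIT6
import Summits.Ventures.PercRepro2.CaseOneGadgetUWA1BBlockIT7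
import Summits.Ventures.PercRepro2.CaseOneGadgetUWA1BBlockIT8
import Summits.Ventures.PercRepro2.CaseOneGadgetUWA1BBlockIT9
import Summits.Ventures.PercRepro2.CaseOneGadgetUWA1BBlockIT10
import Summits.Ventures.PercRepro2.CaseOneGadgetUWA1BBlockIT11
import Summits.Ventures.PercRepro2.CaseOneGadgetUWA1BBlockIT12
import Summits.Ventures.PercRepro2.CaseOneGadgetUWA1BBlockIT13

/-!
# The gadget `u ~ {w, a₁, b}`, `w ~ {u, a₂, o}` (uwa1b): the cell certificates of `iTAB5` (part 51a)
(blind cell PercRepro2, p1 g34; the fourth gadget anchor of the six-form calculus — all six forms of the uwa1b gadget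
as plain SFacts-cone certificate chains, generated by mining/p1/g34/uwa1b/genu.py = p1 g33's gent_uwa1.py / g25's
geno.py re-targeted; P1-G33 §6–§6″, P1-G34)

Each `eBABIT ijk kl` is a nonnegative combination of `(pairwise atom) × (cell)` and cubic cell monomials — or, for the degree-4 ones, `M × eBABIT ijk kl` (`M = Σ cᵢ` the total cell mass) is a nonnegative combination of `(atom) × (cell) × (cell)` and quartic cell monomials, then `SFacts.nonneg_of_sum_mul` (`CaseOneStarCertT1`) — exact LP certificates (kit j317114, every certificate re-verified exactly; data/p1/g33/gcerts_uwa1b.json, form `i-T`), here as exact `linear_combination`s over `SFacts` (the rational coefficients cleared by their common denominator). -/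

namespace Summit.Ventures.PercRepro2

namespace CaseOne

section CertABIT51a
variable {R : Type*} [Field R] [LinearOrder R] [IsStrictOrderedRing R]

set_option maxHeartbeats 0 in
/-- `eBABIT22311 ≥ 0`: the combination is identically zero (`ring`). -/
lemma eBABIT22311_nonneg (m : SCells R) (_hf : SFacts m) : 0 ≤ eBABIT22311 m := by
  have h : eBABIT22311 m = 0 := by
    unfold eBABIT22311 cBABIT00211 cBABIT01111 cBABIT01211 cBABIT01311 cBABIT02111 cBABIT02211 cBABIT02311 cBABIT10111 cBABIT10211 cBABIT10311 cBABIT11011 cBABIT11111 cBABIT11211 cBABIT11311 cBABIT12011 cBABIT12111 cBABIT12211 cBABIT12311 cBABIT20011 cBABIT20111 cBABIT20211 cBABIT20311 cBABIT21011 cBABIT21111 cBABIT21211 cBABIT21311 cBABIT22011 cBABIT22111 cBABIT22211 cBABIT22311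
    ring
  linarith [h]

set_option maxHeartbeats 0 in
/-- `eBABIT22312 ≥ 0`: the combination is identically zero (`ring`). -/
lemma eBABIT22312_nonneg (m : SCells R) (_hf : SFacts m) : 0 ≤ eBABIT22312 m := by
  have h : eBABIT22312 m = 0 := by
    unfold eBABIT22312 cBABIT00212 cBABIT01112 cBABIT01212 cBABIT01312 cBABIT02112 cBABIT02212 cBABIT02312 cBABIT10112 cBABIT10212 cBABIT10312 cBABIT11012 cBABIT11112 cBABIT11212 cBABIT11312 cBABIT12012 cBABIT12112 cBABIT12212 cBABIT12312 cBABIT20012 cBABIT20112 cBABIT20212 cBABIT20312 cBABIT21012 cBABIT21112 cBABIT21212 cBABIT21312 cBABIT22012 cBABIT22112 cBABIT22212 cBABIT22312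
    ring
  linarith [h]

end CertABIT51a

end CaseOne

end Summit.Ventures.PercRepro2
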